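import Summits.AtomisticToContinuum.FouriersLaw.Theorems.BondHeatUncertaintyExtensiveSnapshotIrreversibilityEnergyWindowSkeletonRegularity
import Summits.AtomisticToContinuum.FouriersLaw.Theorems.BondHeatUncertaintyExtensiveSnapshotIrreversibilityEnergyWindowSkeletonRefinement
import Summits.AtomisticToContinuum.FouriersLaw.Theorems.BondHeatUncertaintyExtensiveSnapshotIrreversibilityEnergyWindowKernelTestClasses

/-!
# Energy window, part T-b (file 3 of 3) — the skeleton transfer identities (arrival and departure) at
every level `m` and every `κ > 0`; the kernel side

Lineage `stmt-AtomisticToContinuum-9121` (`ExtensiveSnapshotIrreversibility`), K_fix half, leaf S3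
`KernelTemperatureLipschitz`; record S3 ⟸ (Dˢ) ∧ (G1ℓ) ∧ (G1*ᶜᶜ) [Rᵇ], (G1ℓ) ⟸ (SWM) ∧ (JM),
(G1*ᶜᶜ) ⟸ (SWM) (glue parts S–V).  Cell decomp-a2c, lens «grading / quantitative ladder», generation 79,
part T «SkeletonIdentities» (critic rows 1077 (d), 1086 (c), 1093 (g)) = five files: T-a
`…SkeletonVariation` (§1–§3, §6) → `…SkeletonJacobianMoments` (§4–§5) and T-b `…SkeletonCoordinates`
(§1–§3) → `…SkeletonRegularity` (§4) → `…SkeletonIdentities` (§5–§6); section numbers refer to the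
part (T-a resp. T-b) as a whole.

THIS FILE (T-b §5–§6).  With `ℓ = Dg(E x)` in file 1's pointwise transfer identity and the chain rule
`∂_j (g∘E)(x) = Dg(E x)[D E(x) b_j]` (`fderiv_comp_skelFlowMapAt_apply`), part S's level-`m` Gaussian
integration by parts along the Brownian path (`wienerPair_skeleton_ibp_skorokhod`:
`E[G δ_m(u)] = 2^{-m} E[Σ_j ∂_j G u_j]`) gives, for every level `m` and every `κ > 0`,
* ARRIVAL (`c = e_{p_b}`; ★ `inv_mul_sum_fderiv_mul_skelFieldArr` pointwise, ★★ `integral_mul_skelWeightArr_eq`):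
  `E[g(X_s) w_{m,κ}] = E[(∂_{p_b} g)(X_s) − κ Dg(X_s)[a_{m,κ}♯]]`;
* DEPARTURE (`c = V = ∂_z X_s[e_{p_b}]`; ★ `…FieldDep`, ★★ `integral_mul_skelWeightDep_eq`):
  `E[g(X_s) w'_{m,κ}] = E[∂_{p_b}^{z} (g(X_s^{z})) − κ Dg(X_s)[a'_{m,κ}♯]]`,
for `g ∈ C¹`, under EXACTLY the four `L¹(wienerPair)` conditions of the integration by parts (the
products `G u_j`, `x_j G u_j`, `∂_jG u_j`, `G ∂_j u_j`); its other inputs (joint measurability,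
differentiability in the skeleton) are DISCHARGED by file 2.  The regularisation defect `κ Dg[a♯]` is
carried EXACTLY — no limit is taken here.  §6 rewrites the kernel side: `∫ φ dP^δ_s(z,·)` and
`P⁰_r h (w)` are the corresponding Wiener expectations (`pinnedChain_integral_transitionKernel`, R
`pinnedChain_solMap_eq_skelFlowMapAt`; `0 ≤ s` load-bearing), and ★ `integral_partialP_pertKernel_eq`:
`∫ (∂_{p_b} g) dP^δ_s(z,·) = E[(∂_{p_b} g)(X_s)]` for `g ∈ C¹` — the integrand of `(G1*ᶜᶜ)` is LITERALLY
the first term of the arrival identity, and `(G1ℓ)`'s `eqKernelFun` is the Wiener expectation whose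
`z`-derivative the departure identity transfers.
WHAT REMAINS for `(G1*ᶜᶜ)`, `(G1ℓ)` (parts U/V, generation 80): the four `L¹` conditions and the `L^q`
bounds of the two weights — (JMˣ)₁ (T-a, PROVED), (JMˣ)₂ (T-a, leaf), (SWM) (R, leaf) — and the
`κ → 0⁺`, level-`m` bookkeeping of part S file 4 (`defect_sq_le_normSq`, `tendsto_defect`).
No new leaves, no instance / notation / option; no proof holes.
References: D. Nualart, The Malliavin Calculus and Related Topics (2006), Prop. 1.3.1, §2.3;
N. Cuneo, J.-P. Eckmann, M. Hairer, L. Rey-Bellet, Electron. J. Probab. 23 (2018), §3 eq. (3.4)–(3.6);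
R. Horn, C. Johnson, Matrix Analysis, §0.8 (adjugate / Cramer). [folklore]
-/

noncomputable section

namespace Summit.AtomisticToContinuum.FouriersLaw.Theorems.ExtensiveSnapshotIrreversibility.EnergyWindow

open MeasureTheory ProbabilityTheory Filter Topology Set
open scoped ENNReal NNReal Matrix ContDiff
open Literature.MathematicalPhysics.KineticTheory.HeatConduction
open Literature.Probability.Process

/-! ## 5. The arrival and departure identities -/

section Identities

variable {ω₂ lam β γ : ℝ} (hω : 0 < ω₂) (hl : 0 ≤ lam) (hβ : 0 ≤ β) (hγ : 0 ≤ γ) (N : ℕ)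
  (T_L T_R : ℝ)

include hω hl hβ hγ

/-- Chain rule along the skeleton flow: `∂_δ (g ∘ E)(x) = Dg(E x)[D E(x) δ]`. [folklore] -/
theorem fderiv_comp_skelFlowMapAt_apply {s : ℝ} (hs : s ∈ Icc (0 : ℝ) 1) (m : ℕ) (z : PhaseSpace N)
    (r : WienerPair) (x : PairSkeleton m) {g : PhaseSpace N → ℝ}
    (hg : DifferentiableAt ℝ g (skelFlowMapAt ω₂ lam β γ N T_L T_R s m z r x)) (δ : PairSkeleton m) :
    fderiv ℝ (fun y => g (skelFlowMapAt ω₂ lam β γ N T_L T_R s m z r y)) x δ =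
      fderiv ℝ g (skelFlowMapAt ω₂ lam β γ N T_L T_R s m z r x)
        (fderiv ℝ (skelFlowMapAt ω₂ lam β γ N T_L T_R s m z r) x δ) := by
  have hE : DifferentiableAt ℝ (skelFlowMapAt ω₂ lam β γ N T_L T_R s m z r) x :=
    (contDiff_skelFlowMapAt hω hl hβ hγ N T_L T_R hs m z r).differentiable (by simp) x
  rw [fderiv_fun_comp x hg hE]
  rfl

/-- ★ **Arrival, pointwise**: `2^{-m} Σ_j ∂_j(g∘E)(x) u_j(x) = (∂_{p_b} g)(E x) − κ Dg(E x)[a♯]`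
(`κ > 0`, every level `m`, every differentiability point of `g`). [folklore]
[cite: Nualart2006, §2.3] -/
theorem inv_mul_sum_fderiv_mul_skelFieldArr {s : ℝ} (hs : s ∈ Icc (0 : ℝ) 1) (m : ℕ) {κ : ℝ}
    (hκ : 0 < κ) (b : Fin N) (z : PhaseSpace N) (r : WienerPair) (x : PairSkeleton m)
    {g : PhaseSpace N → ℝ} (hg : DifferentiableAt ℝ g (skelFlowMapAt ω₂ lam β γ N T_L T_R s m z r x)) :
    ((2 : ℝ) ^ m)⁻¹ * ∑ j,
        fderiv ℝ (fun y => g (skelFlowMapAt ω₂ lam β γ N T_L T_R s m z r y)) x (basisX m j) *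
          skelFieldArr ω₂ lam β γ N T_L T_R s m κ b z r x j =
      partialP b g (skelFlowMapAt ω₂ lam β γ N T_L T_R s m z r x) -
        κ * fderiv ℝ g (skelFlowMapAt ω₂ lam β γ N T_L T_R s m z r x)
          (ofCoordV N (skelCtrlArr ω₂ lam β γ N T_L T_R s m κ b z r x)) := by
  simp only [fderiv_comp_skelFlowMapAt_apply hω hl hβ hγ N T_L T_R hs m z r x hg]
  unfold skelFieldArr skelCtrlArr
  rw [inv_mul_sum_apply_fderiv_mul_vecMul κ hκ z r x (momCoord N b), ofCoordV_momCoord,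
    ← partialP_eq_fderiv_apply b hg]

/-- ★ **Departure, pointwise**: `2^{-m} Σ_j ∂_j(g∘E)(x) u'_j(x) = ∂^{z}_{p_b}(g(E_{z}(x))) − κ Dg(E x)[a'♯]`.
[folklore] [cite: Nualart2006, §2.3] -/
theorem inv_mul_sum_fderiv_mul_skelFieldDep {s : ℝ} (hs : s ∈ Icc (0 : ℝ) 1) (m : ℕ) {κ : ℝ}
    (hκ : 0 < κ) (b : Fin N) (z : PhaseSpace N) (r : WienerPair) (x : PairSkeleton m)
    {g : PhaseSpace N → ℝ} (hg : DifferentiableAt ℝ g (skelFlowMapAt ω₂ lam β γ N T_L T_R s m z r x)) :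
    ((2 : ℝ) ^ m)⁻¹ * ∑ j,
        fderiv ℝ (fun y => g (skelFlowMapAt ω₂ lam β γ N T_L T_R s m z r y)) x (basisX m j) *
          skelFieldDep ω₂ lam β γ N T_L T_R s m κ b z r x j =
      partialP b (fun z' => g (skelFlowMapAt ω₂ lam β γ N T_L T_R s m z' r x)) z -
        κ * fderiv ℝ g (skelFlowMapAt ω₂ lam β γ N T_L T_R s m z r x)
          (ofCoordV N (skelCtrlDep ω₂ lam β γ N T_L T_R s m κ b z r x)) := by
  have hz : DifferentiableAt ℝ (fun z' => skelFlowMapAt ω₂ lam β γ N T_L T_R s m z' r x) z :=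
    (contDiff_skelFlowMapAt_left hω hl hβ hγ N T_L T_R hs m r x).differentiable (by simp) z
  have hgz : DifferentiableAt ℝ
      (fun z' => g (skelFlowMapAt ω₂ lam β γ N T_L T_R s m z' r x)) z := hg.comp z hz
  simp only [fderiv_comp_skelFlowMapAt_apply hω hl hβ hγ N T_L T_R hs m z r x hg]
  unfold skelFieldDep skelCtrlDep
  rw [inv_mul_sum_apply_fderiv_mul_vecMul κ hκ z r x, skelDepVec, ofCoordV_coordV,
    partialP_eq_fderiv_apply b hgz, fderiv_fun_comp z hg hz, ContinuousLinearMap.comp_apply]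

/-- ★★ **The arrival identity** (every level `m`, every `κ > 0`, `g ∈ C¹`):
`E[g(X_s) w_{m,κ}] = E[(∂_{p_b} g)(X_s) − κ Dg(X_s)[a_{m,κ}♯]]`, `X_s = E^{s}_{m,z,R}(Ξ)` along the
driving path, under the four `L¹(wienerPair)` conditions of the level-`m` Gaussian integration by
parts (part S file 3); all measurability / differentiability inputs are discharged (§4).
[cite: Nualart2006, Prop 1.3.1] [cite: CuneoEckmannHairerReyBellet2018, §3 eq. (3.4)] -/
theorem integral_mul_skelWeightArr_eq {s : ℝ} (hs : s ∈ Icc (0 : ℝ) 1) (m : ℕ) {κ : ℝ}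
    (hκ : 0 < κ) (b : Fin N) (z : PhaseSpace N) {g : PhaseSpace N → ℝ} (hg : ContDiff ℝ 1 g)
    (hGu : ∀ j, Integrable (fun wp =>
      g (skelFlowMapAt ω₂ lam β γ N T_L T_R s m z (pairRem m wp) (pairSkel m wp)) *
        skelFieldArr ω₂ lam β γ N T_L T_R s m κ b z (pairRem m wp) (pairSkel m wp) j) wienerPair)
    (hxGu : ∀ j, Integrable (fun wp => coordX m (pairSkel m wp) j *
      (g (skelFlowMapAt ω₂ lam β γ N T_L T_R s m z (pairRem m wp) (pairSkel m wp)) *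
        skelFieldArr ω₂ lam β γ N T_L T_R s m κ b z (pairRem m wp) (pairSkel m wp) j)) wienerPair)
    (hdGu : ∀ j, Integrable (fun wp =>
      fderiv ℝ (fun y => g (skelFlowMapAt ω₂ lam β γ N T_L T_R s m z (pairRem m wp) y))
          (pairSkel m wp) (basisX m j) *
        skelFieldArr ω₂ lam β γ N T_L T_R s m κ b z (pairRem m wp) (pairSkel m wp) j) wienerPair)
    (hGdu : ∀ j, Integrable (fun wp =>
      g (skelFlowMapAt ω₂ lam β γ N T_L T_R s m z (pairRem m wp) (pairSkel m wp)) *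
        fderiv ℝ (fun y => skelFieldArr ω₂ lam β γ N T_L T_R s m κ b z (pairRem m wp) y j)
          (pairSkel m wp) (basisX m j)) wienerPair) :
    ∫ wp, g (skelFlowMapAt ω₂ lam β γ N T_L T_R s m z (pairRem m wp) (pairSkel m wp)) *
        skelWeightArr ω₂ lam β γ N T_L T_R s m κ b z (pairRem m wp) (pairSkel m wp) ∂wienerPair =
      ∫ wp, (partialP b g (skelFlowMapAt ω₂ lam β γ N T_L T_R s m z (pairRem m wp) (pairSkel m wp)) -
        κ * fderiv ℝ g (skelFlowMapAt ω₂ lam β γ N T_L T_R s m z (pairRem m wp) (pairSkel m wp))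
          (ofCoordV N (skelCtrlArr ω₂ lam β γ N T_L T_R s m κ b z (pairRem m wp) (pairSkel m wp))))
        ∂wienerPair := by
  have hgd : Differentiable ℝ g := hg.differentiable one_ne_zero
  have hEd : ∀ r : WienerPair, Differentiable ℝ (skelFlowMapAt ω₂ lam β γ N T_L T_R s m z r) :=
    fun r => (contDiff_skelFlowMapAt hω hl hβ hγ N T_L T_R hs m z r).differentiable (by simp)
  have hGm : Measurable fun p : PairSkeleton m × WienerPair =>
      g (skelFlowMapAt ω₂ lam β γ N T_L T_R s m z p.2 p.1) :=
    hg.continuous.measurable.comp (measurable_skelFlowMapAt hω hl hβ hγ N T_L T_R s m z)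
  have hGd : ∀ r : WienerPair, Differentiable ℝ fun y =>
      g (skelFlowMapAt ω₂ lam β γ N T_L T_R s m z r y) := fun r => hgd.comp (hEd r)
  have hud : ∀ (r : WienerPair) j, Differentiable ℝ fun y =>
      skelFieldArr ω₂ lam β γ N T_L T_R s m κ b z r y j := fun r j =>
    (contDiff_skelFieldArr_apply hω hl hβ hγ N T_L T_R hs m hκ b z r j).differentiable (by simp)
  have h := wienerPair_skeleton_ibp_skorokhod m
    (G := fun p : PairSkeleton m × WienerPair =>
      g (skelFlowMapAt ω₂ lam β γ N T_L T_R s m z p.2 p.1))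
    (u := fun p : PairSkeleton m × WienerPair =>
      skelFieldArr ω₂ lam β γ N T_L T_R s m κ b z p.2 p.1)
    hGm (measurable_skelFieldArr_apply hω hl hβ hγ N T_L T_R hs m κ b z)
    (fun j => measurable_fderiv_apply_of_param
      (fun p : PairSkeleton m × WienerPair =>
        g (skelFlowMapAt ω₂ lam β γ N T_L T_R s m z p.2 p.1)) hGm (fun r x => hGd r x)
      (basisX m j))
    (fun j => measurable_fderiv_apply_of_param
      (fun p : PairSkeleton m × WienerPair => skelFieldArr ω₂ lam β γ N T_L T_R s m κ b z p.2 p.1 j)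
      (measurable_skelFieldArr_apply hω hl hβ hγ N T_L T_R hs m κ b z j) (fun r x => hud r j x)
      (basisX m j))
    hGd hud hGu hxGu hdGu hGdu
  have h' : ∫ wp, g (skelFlowMapAt ω₂ lam β γ N T_L T_R s m z (pairRem m wp) (pairSkel m wp)) *
      skelWeightArr ω₂ lam β γ N T_L T_R s m κ b z (pairRem m wp) (pairSkel m wp) ∂wienerPair =
      ((2 : ℝ) ^ m)⁻¹ * ∫ wp, ∑ j,
        fderiv ℝ (fun y => g (skelFlowMapAt ω₂ lam β γ N T_L T_R s m z (pairRem m wp) y))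
            (pairSkel m wp) (basisX m j) *
          skelFieldArr ω₂ lam β γ N T_L T_R s m κ b z (pairRem m wp) (pairSkel m wp) j
        ∂wienerPair := h
  rw [h', ← integral_const_mul]
  refine integral_congr_ae (Eventually.of_forall fun wp => ?_)
  exact inv_mul_sum_fderiv_mul_skelFieldArr hω hl hβ hγ N T_L T_R hs m hκ b z (pairRem m wp)
    (pairSkel m wp) (hgd _)

/-- ★★ **The departure identity** (every level `m`, every `κ > 0`, `g ∈ C¹`):
`E[g(X_s) w'_{m,κ}] = E[∂^{z}_{p_b}(g(X^{z}_s)) − κ Dg(X_s)[a'_{m,κ}♯]]`, under the four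
`L¹(wienerPair)` conditions of the level-`m` Gaussian integration by parts.
[cite: Nualart2006, Prop 1.3.1] [cite: CuneoEckmannHairerReyBellet2018, §3 eq. (3.5)] -/
theorem integral_mul_skelWeightDep_eq {s : ℝ} (hs : s ∈ Icc (0 : ℝ) 1) (m : ℕ) {κ : ℝ}
    (hκ : 0 < κ) (b : Fin N) (z : PhaseSpace N) {g : PhaseSpace N → ℝ} (hg : ContDiff ℝ 1 g)
    (hGu : ∀ j, Integrable (fun wp =>
      g (skelFlowMapAt ω₂ lam β γ N T_L T_R s m z (pairRem m wp) (pairSkel m wp)) *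
        skelFieldDep ω₂ lam β γ N T_L T_R s m κ b z (pairRem m wp) (pairSkel m wp) j) wienerPair)
    (hxGu : ∀ j, Integrable (fun wp => coordX m (pairSkel m wp) j *
      (g (skelFlowMapAt ω₂ lam β γ N T_L T_R s m z (pairRem m wp) (pairSkel m wp)) *
        skelFieldDep ω₂ lam β γ N T_L T_R s m κ b z (pairRem m wp) (pairSkel m wp) j)) wienerPair)
    (hdGu : ∀ j, Integrable (fun wp =>
      fderiv ℝ (fun y => g (skelFlowMapAt ω₂ lam β γ N T_L T_R s m z (pairRem m wp) y))
          (pairSkel m wp) (basisX m j) *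
        skelFieldDep ω₂ lam β γ N T_L T_R s m κ b z (pairRem m wp) (pairSkel m wp) j) wienerPair)
    (hGdu : ∀ j, Integrable (fun wp =>
      g (skelFlowMapAt ω₂ lam β γ N T_L T_R s m z (pairRem m wp) (pairSkel m wp)) *
        fderiv ℝ (fun y => skelFieldDep ω₂ lam β γ N T_L T_R s m κ b z (pairRem m wp) y j)
          (pairSkel m wp) (basisX m j)) wienerPair) :
    ∫ wp, g (skelFlowMapAt ω₂ lam β γ N T_L T_R s m z (pairRem m wp) (pairSkel m wp)) *
        skelWeightDep ω₂ lam β γ N T_L T_R s m κ b z (pairRem m wp) (pairSkel m wp) ∂wienerPair =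
      ∫ wp, (partialP b (fun z' =>
          g (skelFlowMapAt ω₂ lam β γ N T_L T_R s m z' (pairRem m wp) (pairSkel m wp))) z -
        κ * fderiv ℝ g (skelFlowMapAt ω₂ lam β γ N T_L T_R s m z (pairRem m wp) (pairSkel m wp))
          (ofCoordV N (skelCtrlDep ω₂ lam β γ N T_L T_R s m κ b z (pairRem m wp) (pairSkel m wp))))
        ∂wienerPair := by
  have hgd : Differentiable ℝ g := hg.differentiable one_ne_zero
  have hEd : ∀ r : WienerPair, Differentiable ℝ (skelFlowMapAt ω₂ lam β γ N T_L T_R s m z r) :=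
    fun r => (contDiff_skelFlowMapAt hω hl hβ hγ N T_L T_R hs m z r).differentiable (by simp)
  have hGm : Measurable fun p : PairSkeleton m × WienerPair =>
      g (skelFlowMapAt ω₂ lam β γ N T_L T_R s m z p.2 p.1) :=
    hg.continuous.measurable.comp (measurable_skelFlowMapAt hω hl hβ hγ N T_L T_R s m z)
  have hGd : ∀ r : WienerPair, Differentiable ℝ fun y =>
      g (skelFlowMapAt ω₂ lam β γ N T_L T_R s m z r y) := fun r => hgd.comp (hEd r)
  have hud : ∀ (r : WienerPair) j, Differentiable ℝ fun y =>
      skelFieldDep ω₂ lam β γ N T_L T_R s m κ b z r y j := fun r j =>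
    (contDiff_skelFieldDep_apply hω hl hβ hγ N T_L T_R hs m hκ b z r j).differentiable (by simp)
  have h := wienerPair_skeleton_ibp_skorokhod m
    (G := fun p : PairSkeleton m × WienerPair =>
      g (skelFlowMapAt ω₂ lam β γ N T_L T_R s m z p.2 p.1))
    (u := fun p : PairSkeleton m × WienerPair =>
      skelFieldDep ω₂ lam β γ N T_L T_R s m κ b z p.2 p.1)
    hGm (measurable_skelFieldDep_apply hω hl hβ hγ N T_L T_R hs m κ b z)
    (fun j => measurable_fderiv_apply_of_param
      (fun p : PairSkeleton m × WienerPair =>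
        g (skelFlowMapAt ω₂ lam β γ N T_L T_R s m z p.2 p.1)) hGm (fun r x => hGd r x)
      (basisX m j))
    (fun j => measurable_fderiv_apply_of_param
      (fun p : PairSkeleton m × WienerPair => skelFieldDep ω₂ lam β γ N T_L T_R s m κ b z p.2 p.1 j)
      (measurable_skelFieldDep_apply hω hl hβ hγ N T_L T_R hs m κ b z j) (fun r x => hud r j x)
      (basisX m j))
    hGd hud hGu hxGu hdGu hGdu
  have h' : ∫ wp, g (skelFlowMapAt ω₂ lam β γ N T_L T_R s m z (pairRem m wp) (pairSkel m wp)) *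
      skelWeightDep ω₂ lam β γ N T_L T_R s m κ b z (pairRem m wp) (pairSkel m wp) ∂wienerPair =
      ((2 : ℝ) ^ m)⁻¹ * ∫ wp, ∑ j,
        fderiv ℝ (fun y => g (skelFlowMapAt ω₂ lam β γ N T_L T_R s m z (pairRem m wp) y))
            (pairSkel m wp) (basisX m j) *
          skelFieldDep ω₂ lam β γ N T_L T_R s m κ b z (pairRem m wp) (pairSkel m wp) j
        ∂wienerPair := h
  rw [h', ← integral_const_mul]
  refine integral_congr_ae (Eventually.of_forall fun wp => ?_)
  exact inv_mul_sum_fderiv_mul_skelFieldDep hω hl hβ hγ N T_L T_R hs m hκ b z (pairRem m wp)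
    (pairSkel m wp) (hgd _)

end Identities

/-! ## 6. The kernel side: the integrals of `(G1*ᶜᶜ)` / `(G1ℓ)` as Wiener expectations -/

section Kernel

variable {ω₂ lam β γ : ℝ} (hω : 0 < ω₂) (hl : 0 ≤ lam) (hβ : 0 ≤ β) (hγ : 0 ≤ γ) (N : ℕ)

include hω hl hβ hγ

/-- `∫ φ dP^δ_s(z, ·) = E[φ(Φ_s(z, B))]` for measurable `φ` and real `s ≥ 0` (baths `T ± δ/2`;
both sides junk `0` together). [cite: CuneoEckmannHairerReyBellet2018, §3 p. 7] -/
theorem integral_pertKernel_eq_integral_solMap (T δ : ℝ) {s : ℝ} (hs : 0 ≤ s) (z : PhaseSpace N)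
    {φ : PhaseSpace N → ℝ} (hφ : Measurable φ) :
    ∫ w, φ w ∂(pertKernel ω₂ lam β γ T δ N s z) =
      ∫ wp, φ ((pinnedChain ω₂ lam β γ).solMap N (T + δ / 2) (T - δ / 2) s z (pairPath wp))
        ∂wienerPair := by
  rw [pertKernel, pinnedChain_integral_transitionKernel hω hl hβ hγ N (T + δ / 2) (T - δ / 2)
    s.toNNReal z hφ.aestronglyMeasurable, Real.coe_toNNReal _ hs]

/-- `∫ φ dP^δ_s(z, ·) = E[φ(E^{s}_{m,z,R}(Ξ))]` at every level `m`, `s ∈ [0, 1]` (R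
`pinnedChain_solMap_eq_skelFlowMapAt`). [folklore] -/
theorem integral_pertKernel_eq_integral_skelFlowMapAt (T δ : ℝ) {s : ℝ} (hs : s ∈ Icc (0 : ℝ) 1)
    (m : ℕ) (z : PhaseSpace N) {φ : PhaseSpace N → ℝ} (hφ : Measurable φ) :
    ∫ w, φ w ∂(pertKernel ω₂ lam β γ T δ N s z) =
      ∫ wp, φ (skelFlowMapAt ω₂ lam β γ N (T + δ / 2) (T - δ / 2) s m z (pairRem m wp)
        (pairSkel m wp)) ∂wienerPair := by
  rw [integral_pertKernel_eq_integral_solMap hω hl hβ hγ N T δ hs.1 z hφ]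
  simp_rw [pinnedChain_solMap_eq_skelFlowMapAt hω hl hβ hγ N (T + δ / 2) (T - δ / 2) hs m z]

/-- `P⁰_r h (w) = E[h(Φ_r(w, B))]` (equal baths `T`, real `r ≥ 0`, measurable `h`).
[cite: CuneoEckmannHairerReyBellet2018, eq. (2.3)] -/
theorem eqKernelFun_eq_integral_solMap (T : ℝ) {r : ℝ} (hr : 0 ≤ r) {h : PhaseSpace N → ℝ}
    (hh : Measurable h) (w : PhaseSpace N) :
    eqKernelFun ω₂ lam β γ T N h r w =
      ∫ wp, h ((pinnedChain ω₂ lam β γ).solMap N T T r w (pairPath wp)) ∂wienerPair := by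
  unfold eqKernelFun
  rw [pinnedChain_integral_transitionKernel hω hl hβ hγ N T T r.toNNReal w hh.aestronglyMeasurable,
    Real.coe_toNNReal _ hr]

/-- `P⁰_r h (w) = E[h(E^{r}_{m,w,R}(Ξ))]` at every level `m`, `r ∈ [0, 1]`. [folklore] -/
theorem eqKernelFun_eq_integral_skelFlowMapAt (T : ℝ) {r : ℝ} (hr : r ∈ Icc (0 : ℝ) 1) (m : ℕ)
    {h : PhaseSpace N → ℝ} (hh : Measurable h) (w : PhaseSpace N) :
    eqKernelFun ω₂ lam β γ T N h r w =
      ∫ wp, h (skelFlowMapAt ω₂ lam β γ N T T r m w (pairRem m wp) (pairSkel m wp))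
        ∂wienerPair := by
  rw [eqKernelFun_eq_integral_solMap hω hl hβ hγ N T hr.1 hh w]
  simp_rw [pinnedChain_solMap_eq_skelFlowMapAt hω hl hβ hγ N T T hr m w]

/-- ★ **The integrand of `(G1*ᶜᶜ)` is the arrival expectation**: for `g ∈ C¹`, `s ∈ [0, 1]`,
`∫ (∂_{p_b} g) dP^δ_s(z, ·) = E[(∂_{p_b} g)(E^{s}_{m,z,R}(Ξ))]` at every level `m` — the first
term of the right-hand side of the arrival identity (§5) with baths `T ± δ/2`. [folklore] -/
theorem integral_partialP_pertKernel_eq (T δ : ℝ) {s : ℝ} (hs : s ∈ Icc (0 : ℝ) 1) (m : ℕ)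
    (b : Fin N) (z : PhaseSpace N) {g : PhaseSpace N → ℝ} (hg : ContDiff ℝ 1 g) :
    ∫ w, partialP b g w ∂(pertKernel ω₂ lam β γ T δ N s z) =
      ∫ wp, partialP b g (skelFlowMapAt ω₂ lam β γ N (T + δ / 2) (T - δ / 2) s m z (pairRem m wp)
        (pairSkel m wp)) ∂wienerPair :=
  integral_pertKernel_eq_integral_skelFlowMapAt hω hl hβ hγ N T δ hs m z
    (continuous_partialP_of_contDiff b hg).measurable

end Kernel

end Summit.AtomisticToContinuum.FouriersLaw.Theorems.ExtensiveSnapshotIrreversibility.EnergyWindow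

end
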